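import Summits.HubbardSuperconductivity.HubbardSuperconductivity.Theorems.DeformationLadderApproximatingHamiltonianGCSourcedSquares
import Summits.HubbardSuperconductivity.HubbardSuperconductivity.Theorems.DeformationLadderApproximatingHamiltonianGCSourcedTorus
import Summits.HubbardSuperconductivity.HubbardSuperconductivity.Theorems.WeakCouplingBCSWcbcsBcsConstructionTorusBoxComparison

/-!
# Route `DeformationLadder`, item `ApproximatingHamiltonianGC` (stmt-HubbardSuperconductivity-1895):
# torus versus box, and the thermodynamic limit of the `d`-wave SOURCE energy densities on the tori

Support file (`--supports stmt-HubbardSuperconductivity-1895`), continuing `…SourcedTorus.lean` and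
`…SourcedSquares.lean`.

* `dlst_torus_box_compare`: on the common vertex set `FermionTorus 2 L`,
  `|E₀(dWaveSourceTorus L U μ h) − E₀(box with d-wave weight)| ≤ (2 + 24|h|)·20L` — the adjacencies differ on
  `≤ 4L` ordered pairs (`card_filter_le_of_not_adj_iff`), the weights on `≤ 20L` by `≤ 6|h|`
  (`dlsc_groundEnergy_le_of_mismatch`, both directions);
* `dlst_box_eq_rect`: the box on the torus vertex set is the `L × L` rectangle (graph isomorphism
  `x ↦ (x₀,x₁)` transporting the weight);
* `dlst_source_energyDensity_limit`: **for every `U, μ, h`, `E₀(dWaveSourceTorus (L+1) U μ h)/(L+1)²`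
  converges** — the free-boundary limit along squares (`dlsb_rect_energyDensity_limit`) plus the `O(L)`
  comparison. This is exactly the hypothesis of the reduction `approximatingHamiltonianGC_of_sourceLimit`
  (`…GCAssembly.lean`).

Ruelle, *Statistical Mechanics: Rigorous Results* (1969) §2. No definitions are introduced.
-/

set_option linter.dupNamespace false

noncomputable section

namespace Summit.HubbardSuperconductivity.HubbardSuperconductivity.Theorems

open Matrix Finset Literature.MathematicalPhysics.QuantumLattice
open Literature.MathematicalPhysics.QuantumLattice.ThermodynamicLimit
open Literature.Barriers.HubbardSuperconductivity (bondPair bondPair_conjTranspose norm_bondPair_le_two)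
open scoped ComplexOrder Matrix.Norms.L2Operator

/-! #### Torus versus box: the energy comparison and the thermodynamic limit -/

section TorusLimit

open Literature.Probability.LatticeModels Filter Topology

/-- `|d(e)/√2| ≤ 1`. [folklore] -/
theorem dlst_abs_dWave_div_sqrt_two_le_one (e : Site 2) : |dWaveFormFactor e / Real.sqrt 2| ≤ 1 := by
  rw [abs_div, abs_of_pos (Real.sqrt_pos.2 (by norm_num : (0 : ℝ) < 2)),
    div_le_one (Real.sqrt_pos.2 (by norm_num : (0 : ℝ) < 2))]
  exact (abs_dWaveFormFactor_le_one e).trans (Real.one_le_sqrt.2 (by norm_num))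

variable (L : ℕ) [NeZero L]

/-- The torus weight is bounded by `5|h|` (at most five steps, each of weight `≤ |h|`). [folklore] -/
theorem dlst_abs_torusWeight_le (h : ℝ) (p q : FermionTorus 2 L) :
    |h * ∑ e ∈ insert (0 : Site 2) unitSteps,
        (if FermionTorus.ofTorusSite (FermionTorus.toTorusSite p + Torus.proj L e) = q
          then dWaveFormFactor e / Real.sqrt 2 else 0)| ≤ |h| * 5 := by
  rw [abs_mul]
  refine mul_le_mul_of_nonneg_left ?_ (abs_nonneg h)
  refine (Finset.abs_sum_le_sum_abs _ _).trans ?_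
  calc ∑ e ∈ insert (0 : Site 2) unitSteps,
        |(if FermionTorus.ofTorusSite (FermionTorus.toTorusSite p + Torus.proj L e) = q
          then dWaveFormFactor e / Real.sqrt 2 else 0)|
      ≤ ∑ _e ∈ insert (0 : Site 2) unitSteps, (1 : ℝ) := by
        refine Finset.sum_le_sum fun e _ => ?_
        split_ifs
        · exact dlst_abs_dWave_div_sqrt_two_le_one e
        · simp
    _ ≤ 5 := by
        rw [Finset.sum_const, nsmul_eq_mul, mul_one]
        exact_mod_cast twAhm_card_steps_le

/-- **Torus versus box for the `d`-wave-sourced Hubbard Hamiltonian.** On the common vertex set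
`FermionTorus 2 L`, the sourced torus `dWaveSourceTorus L U μ h` and the free-boundary pair-sourced
box (nearest-neighbour graph and `d`-wave weight pulled back from `ℤ²`) have ground energies within
`(2 + 24|h|)·20L`: the adjacencies differ on `≤ 4L` ordered pairs (`card_filter_le_of_not_adj_iff`),
the weights on `≤ 20L` (`dlst_card_weight_mismatch_le`), by `≤ 6|h|`. Ruelle (1969) §2. [folklore] -/
theorem dlst_torus_box_compare (U μ h : ℝ) :
    |(dWaveSourceTorus L U μ h).groundEnergy -
      (hamiltonianWith ((zdGraph 2).comap (fun x : FermionTorus 2 L => fun i : Fin 2 =>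
          ((ofLex x i : ℕ) : ℤ))) 1 U μ -
        ∑ p : FermionTorus 2 L, ∑ q : FermionTorus 2 L,
          ((h * (dWaveFormFactor ((fun i : Fin 2 => ((ofLex q i : ℕ) : ℤ)) -
            fun i : Fin 2 => ((ofLex p i : ℕ) : ℤ)) / Real.sqrt 2) : ℝ) : ℂ) •
            (bondPair p q + (bondPair p q)ᴴ)).groundEnergy| ≤ (2 + 24 * |h|) * (20 * L) := by
  rw [dlst_dWaveSourceTorus_eq_sourced]
  have h4 : 4 * L ≤ 20 * L := by omega
  -- adjacency mismatches, both orders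
  have hA := (card_filter_le_of_not_adj_iff (L := L) _ fun p hp => hp).trans h4
  have hA' := (card_filter_le_of_not_adj_iff (L := L)
    (fun p => ¬ (((zdGraph 2).comap (fun x : FermionTorus 2 L => fun i : Fin 2 =>
      ((ofLex x i : ℕ) : ℤ))).Adj p.1 p.2 ↔ (fermionTorusGraph 2 L).Adj p.1 p.2))
    fun p hp h => hp h.symm).trans h4
  -- weight mismatches, both orders
  have hW := dlst_card_weight_mismatch_le L h
  have hW' : #{pq : FermionTorus 2 L × FermionTorus 2 L |
      h * (dWaveFormFactor ((fun i : Fin 2 => ((ofLex pq.2 i : ℕ) : ℤ)) -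
        fun i : Fin 2 => ((ofLex pq.1 i : ℕ) : ℤ)) / Real.sqrt 2) ≠
      h * (∑ e ∈ insert (0 : Site 2) unitSteps,
        (if FermionTorus.ofTorusSite (FermionTorus.toTorusSite pq.1 + Torus.proj L e) = pq.2
          then dWaveFormFactor e / Real.sqrt 2 else 0))} ≤ 20 * L := by
    refine le_trans (le_of_eq (congrArg Finset.card (Finset.filter_congr fun pq _ => ne_comm))) hW
  -- weight differences
  have hw : ∀ p q : FermionTorus 2 L,
      |h * (∑ e ∈ insert (0 : Site 2) unitSteps,
        (if FermionTorus.ofTorusSite (FermionTorus.toTorusSite p + Torus.proj L e) = q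
          then dWaveFormFactor e / Real.sqrt 2 else 0)) -
      h * (dWaveFormFactor ((fun i : Fin 2 => ((ofLex q i : ℕ) : ℤ)) -
        fun i : Fin 2 => ((ofLex p i : ℕ) : ℤ)) / Real.sqrt 2)| ≤ 6 * |h| := by
    intro p q
    have h1 := dlst_abs_torusWeight_le L h p q
    have h2 := dlsb_abs_coordWeight_le (fun x : FermionTorus 2 L => fun i : Fin 2 =>
      ((ofLex x i : ℕ) : ℤ)) h p q
    refine (abs_sub _ _).trans ?_
    linarith
  have hw' : ∀ p q : FermionTorus 2 L,
      |h * (dWaveFormFactor ((fun i : Fin 2 => ((ofLex q i : ℕ) : ℤ)) -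
        fun i : Fin 2 => ((ofLex p i : ℕ) : ℤ)) / Real.sqrt 2) -
      h * (∑ e ∈ insert (0 : Site 2) unitSteps,
        (if FermionTorus.ofTorusSite (FermionTorus.toTorusSite p + Torus.proj L e) = q
          then dWaveFormFactor e / Real.sqrt 2 else 0))| ≤ 6 * |h| := fun p q => by
    rw [abs_sub_comm]; exact hw p q
  have hle := dlsc_groundEnergy_le_of_mismatch (fermionTorusGraph 2 L)
    ((zdGraph 2).comap (fun x : FermionTorus 2 L => fun i : Fin 2 => ((ofLex x i : ℕ) : ℤ)))
    _ _ hA hW (by positivity) hw 1 U μ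
  have hge := dlsc_groundEnergy_le_of_mismatch
    ((zdGraph 2).comap (fun x : FermionTorus 2 L => fun i : Fin 2 => ((ofLex x i : ℕ) : ℤ)))
    (fermionTorusGraph 2 L) _ _ hA' hW' (by positivity) hw' 1 U μ
  rw [abs_one] at hle hge
  simp only [Nat.cast_mul, Nat.cast_ofNat] at hle hge
  have hh := abs_nonneg h
  have hL0 : (0 : ℝ) ≤ L := Nat.cast_nonneg L
  have e1 : (2 * 1 + 4 * (6 * |h|)) * (20 * (L : ℝ)) = (2 + 24 * |h|) * (20 * L) := by ring
  rw [abs_le]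
  constructor
  · have h2 := sub_left_le_of_le_add hge
    rw [e1] at h2
    rw [neg_le, neg_sub]
    -- `convert`: the `DecidableEq` instance behind `groundEnergy` synthesised for the concrete
    -- torus differs syntactically from the one carried by the general lemma
    convert h2 using 3
    rfl
  · have h2 := sub_left_le_of_le_add hle
    rw [e1] at h2
    convert h2 using 3
    rfl

omit [NeZero L] in
/-- **The box on the torus vertex set is the `L × L` rectangle**: `x ↦ (x₀, x₁)` is a graph
isomorphism transporting the `d`-wave weight, so the pair-sourced ground energies agree. [folklore] -/
theorem dlst_box_eq_rect (U μ h t : ℝ) :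
    (hamiltonianWith ((zdGraph 2).comap (fun x : FermionTorus 2 L => fun i : Fin 2 =>
          ((ofLex x i : ℕ) : ℤ))) t U μ -
        ∑ p : FermionTorus 2 L, ∑ q : FermionTorus 2 L,
          ((h * (dWaveFormFactor ((fun i : Fin 2 => ((ofLex q i : ℕ) : ℤ)) -
            fun i : Fin 2 => ((ofLex p i : ℕ) : ℤ)) / Real.sqrt 2) : ℝ) : ℂ) •
            (bondPair p q + (bondPair p q)ᴴ)).groundEnergy =
      (hamiltonianWith ((zdGraph 2).comap
        (fun p : Lex (Fin L × Fin L) => ![((ofLex p).1 : ℤ), ((ofLex p).2 : ℤ)])) t U μ -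
      ∑ p : Lex (Fin L × Fin L), ∑ q : Lex (Fin L × Fin L),
        ((h * (dWaveFormFactor (![((ofLex q).1 : ℤ), ((ofLex q).2 : ℤ)] -
          ![((ofLex p).1 : ℤ), ((ofLex p).2 : ℤ)]) / Real.sqrt 2) : ℝ) : ℂ) •
          (bondPair p q + (bondPair p q)ᴴ)).groundEnergy := by
  have key : ∀ z : Lex (Fin L × Fin L),
      (fun i : Fin 2 =>
        ((ofLex ((ofLex.trans (((finTwoArrowEquiv (Fin L)).symm).trans toLex)) z) i : ℕ) : ℤ)) =
        ![((ofLex z).1 : ℤ), ((ofLex z).2 : ℤ)] := by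
    intro z
    funext i
    fin_cases i <;> rfl
  have hiso := dlsb_groundEnergy_sourced_eq_of_iso
    ((zdGraph 2).comap (fun p : Lex (Fin L × Fin L) => ![((ofLex p).1 : ℤ), ((ofLex p).2 : ℤ)]))
    ((zdGraph 2).comap (fun x : FermionTorus 2 L => fun i : Fin 2 => ((ofLex x i : ℕ) : ℤ)))
    (ofLex.trans (((finTwoArrowEquiv (Fin L)).symm).trans toLex))
    (fun x y => by rw [SimpleGraph.comap_adj, SimpleGraph.comap_adj, key, key])
    (fun p q : Lex (Fin L × Fin L) => h * (dWaveFormFactor (![((ofLex q).1 : ℤ), ((ofLex q).2 : ℤ)] -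
      ![((ofLex p).1 : ℤ), ((ofLex p).2 : ℤ)]) / Real.sqrt 2))
    (fun p q : FermionTorus 2 L => h * (dWaveFormFactor ((fun i : Fin 2 => ((ofLex q i : ℕ) : ℤ)) -
      fun i : Fin 2 => ((ofLex p i : ℕ) : ℤ)) / Real.sqrt 2))
    (fun p q => by simp only [key]) t U μ
  -- `convert` absorbs the syntactic difference between the `DecidableEq` instances on the torus
  convert hiso using 3

/-- **Thermodynamic limit of the `d`-wave source energy densities on the tori**: for every
`U, μ, h` the ground energy of `dWaveSourceTorus (L+1) U μ h` divided by `(L+1)²` converges as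
`L → ∞` — the free-boundary limit along squares (`dlsb_rect_energyDensity_limit`) and the
`O(L)` torus/box comparison (`dlst_torus_box_compare`). This is the hypothesis of the reduction
`approximatingHamiltonianGC_of_sourceLimit`. Ruelle (1969) §2. [folklore] -/
theorem dlst_source_energyDensity_limit (U μ h : ℝ) :
    ∃ e : ℝ, Tendsto (fun L : ℕ => (dWaveSourceTorus (L + 1) U μ h).groundEnergy /
      ((L + 1 : ℕ) : ℝ) ^ 2) atTop (𝓝 e) := by
  obtain ⟨e, he⟩ := dlsb_rect_energyDensity_limit 1 U μ h
  refine ⟨e, ?_⟩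
  set rect : ℕ → ℝ := fun L => (hamiltonianWith ((zdGraph 2).comap
        (fun p : Lex (Fin (L + 1) × Fin (L + 1)) => ![((ofLex p).1 : ℤ), ((ofLex p).2 : ℤ)])) 1 U μ -
      ∑ p : Lex (Fin (L + 1) × Fin (L + 1)), ∑ q : Lex (Fin (L + 1) × Fin (L + 1)),
        ((h * (dWaveFormFactor (![((ofLex q).1 : ℤ), ((ofLex q).2 : ℤ)] -
          ![((ofLex p).1 : ℤ), ((ofLex p).2 : ℤ)]) / Real.sqrt 2) : ℝ) : ℂ) •
          (bondPair p q + (bondPair p q)ᴴ)).groundEnergy with hrect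
  have he' : Tendsto (fun L : ℕ => rect L / ((L + 1 : ℕ) : ℝ) ^ 2) atTop (𝓝 e) := he
  set C : ℝ := (2 + 24 * |h|) * 20 with hC
  have hbound0 : ∀ L : ℕ, |(dWaveSourceTorus (L + 1) U μ h).groundEnergy - rect L| ≤
      C * ((L + 1 : ℕ) : ℝ) := by
    intro L
    have h1 := dlst_torus_box_compare (L + 1) U μ h
    rw [dlst_box_eq_rect] at h1
    refine h1.trans (le_of_eq ?_)
    rw [hC]; ring
  have hdiff : Tendsto (fun L : ℕ => ((dWaveSourceTorus (L + 1) U μ h).groundEnergy - rect L) /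
      ((L + 1 : ℕ) : ℝ) ^ 2) atTop (𝓝 0) := by
    have hbound : ∀ L : ℕ, |((dWaveSourceTorus (L + 1) U μ h).groundEnergy - rect L) /
        ((L + 1 : ℕ) : ℝ) ^ 2| ≤ C * (((L + 1 : ℕ) : ℝ))⁻¹ := by
      intro L
      have hL : (0 : ℝ) < ((L + 1 : ℕ) : ℝ) := by positivity
      have hL2 : (0 : ℝ) < ((L + 1 : ℕ) : ℝ) ^ 2 := by positivity
      rw [abs_div, abs_of_pos hL2, div_le_iff₀ hL2]
      refine (hbound0 L).trans (le_of_eq ?_)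
      field_simp
    have hmaj : Tendsto (fun L : ℕ => C * (((L + 1 : ℕ) : ℝ))⁻¹) atTop (𝓝 0) := by
      have h1 : Tendsto (fun L : ℕ => (((L + 1 : ℕ) : ℝ))⁻¹) atTop (𝓝 0) :=
        tendsto_inv_atTop_zero.comp (tendsto_natCast_atTop_atTop.comp (tendsto_add_atTop_nat 1))
      simpa using h1.const_mul C
    exact squeeze_zero_norm (fun L => (Real.norm_eq_abs _).trans_le (hbound L)) hmaj
  have := he'.add hdiff
  rw [add_zero] at this
  refine this.congr' (Eventually.of_forall fun L => ?_)
  have hL : (((L + 1 : ℕ) : ℝ)) ^ 2 ≠ 0 := by positivity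
  field_simp
  ring

end TorusLimit

end Summit.HubbardSuperconductivity.HubbardSuperconductivity.Theorems

end
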